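import Summits.Ventures.PercRepro.Night2LocalD2R14SixZeroI

/-!
# PercRepro — the six-element columns of R1₄ without a far preimage, part J: no coloop, the incidence bound
(night-2, gen 16)

The cell `κ = 0`: no coloop of `S` besides `y`, so `S ∖ {y}` is a five-point circuit.  A point `g ∈ G ∖ S` lies in the
closure of at most FOUR pair preimages (`card_pairPre_filter_mem_clF_le_four`): two pair preimages whose pair sets
share a point put `g` on the line `cl {a, b}` of the two remaining points of `S ∖ {y}`, after which every further
pair preimage with `g` in its closure has pair set `{a, b}` or a 2-subset of `S ∖ {y, a, b}`.  Hence
`t · (|G ∖ S| − 1) ≤ 4 · |G ∖ S|` (`mul_card_four_le`) for the number `t` of pair preimages with `|G ∖ cl B| = 3`,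
and there are at most ten pair preimages (`card_pairPre_le_ten`).
-/

namespace PercRepro.Shadow

open Finset PerFlat ThmH

variable {α : Type*} [DecidableEq α] {M : Matroid α} [M.Finite]

open scoped Classical in
/-- Two distinct 2-subsets of a 3-set share a point. -/
theorem inter_nonempty_of_subset_three {T X X' : Finset α} (hT : T.card = 3) (hX : X ⊆ T) (hX' : X' ⊆ T)
    (hc : X.card = 2) (hc' : X'.card = 2) : (X ∩ X').Nonempty := by
  by_contra h
  rw [Finset.not_nonempty_iff_eq_empty] at h
  have hu := Finset.card_union_add_card_inter X X'
  rw [h, Finset.card_empty, hc, hc'] at hu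
  have := Finset.card_le_card (Finset.union_subset hX hX')
  omega

open scoped Classical in
/-- **The incidence bound without coloops**: a point `g ∈ G ∖ S` lies in the closure of at most four pair preimages
(`|S| = 6`, simple matroid). -/
theorem card_pairPre_filter_mem_clF_le_four {G : Finset α} (hG : G ∈ flatsQ M (4 + 1))
    (hsimple : ∀ e ∈ gr M, ∀ f ∈ gr M, e ≠ f → rkN M {e, f} = 2) {y : α} (hyG : y ∈ G)
    (hyc : y ∉ clF M (G.erase y)) {S : Finset α} (hS : S ∈ shadowAt M (4 + 2) 4 (Uq M (4 + 2) 4) G)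
    (h6 : S.card = 6) {g : α} (hg : g ∈ G \ S) :
    ((pairPre M 4 G S).filter (fun B => g ∈ clF M B)).card ≤ 4 := by
  have hGg : G ⊆ gr M := (mem_flatsQ.1 hG).1
  have hSG : S ⊆ G := subset_of_mem_shadowAt hS
  have hyS : y ∈ S := mem_of_mem_shadowAt_of_coloop (by rw [rkN_erase_eq_of_coloop hG hyG hyc]) hS
  have hgS : g ∉ S := (Finset.mem_sdiff.1 hg).2
  have hgG : g ∈ G := (Finset.mem_sdiff.1 hg).1
  -- pair sets are 2-subsets of `S ∖ {y}`
  have hXU : ∀ B ∈ pairPre M 4 G S, S \ B ⊆ S.erase y := by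
    intro B hB e he
    rw [Finset.mem_erase]
    exact ⟨fun h => (Finset.mem_sdiff.1 he).2 (h ▸ mem_of_mem_pairPre hG hyG hyc hB), (Finset.mem_sdiff.1 he).1⟩
  have hU5 : (S.erase y).card = 5 := by rw [Finset.card_erase_of_mem hyS, h6]
  by_contra hcon
  push Not at hcon
  set 𝓕 := (pairPre M 4 G S).filter (fun B => g ∈ clF M B) with h𝓕def
  obtain ⟨B₁, hB₁⟩ : 𝓕.Nonempty := Finset.card_pos.1 (by omega)
  have hcard : 2 < (𝓕.erase B₁).card := by
    rw [Finset.card_erase_of_mem hB₁]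
    omega
  rw [Finset.two_lt_card_iff] at hcard
  obtain ⟨B₂, B₃, B₄, hB₂, hB₃, hB₄, h₂₃, h₂₄, h₃₄⟩ := hcard
  rw [Finset.mem_erase] at hB₂ hB₃ hB₄
  obtain ⟨h₁₂, hB₂⟩ := hB₂
  obtain ⟨h₁₃, hB₃⟩ := hB₃
  obtain ⟨-, -⟩ := hB₄
  rw [h𝓕def, Finset.mem_filter] at hB₁ hB₂ hB₃
  -- two of `X₁, X₂, X₃` share a point
  have hmeet : ∃ B B' : Finset α, B ∈ pairPre M 4 G S ∧ B' ∈ pairPre M 4 G S ∧ B ≠ B' ∧ g ∈ clF M B ∧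
      g ∈ clF M B' ∧ ((S \ B) ∩ (S \ B')).Nonempty := by
    by_cases h12 : ((S \ B₁) ∩ (S \ B₂)).Nonempty
    · exact ⟨B₁, B₂, hB₁.1, hB₂.1, h₁₂.symm, hB₁.2, hB₂.2, h12⟩
    by_cases h13 : ((S \ B₁) ∩ (S \ B₃)).Nonempty
    · exact ⟨B₁, B₃, hB₁.1, hB₃.1, h₁₃.symm, hB₁.2, hB₃.2, h13⟩
    -- `X₂, X₃ ⊆ (S ∖ y) ∖ X₁`, a 3-set
    refine ⟨B₂, B₃, hB₂.1, hB₃.1, h₂₃, hB₂.2, hB₃.2, ?_⟩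
    rw [Finset.not_nonempty_iff_eq_empty] at h12 h13
    have hsub : ∀ B ∈ pairPre M 4 G S, (S \ B₁) ∩ (S \ B) = ∅ → S \ B ⊆ (S.erase y) \ (S \ B₁) := by
      intro B hB hdis e he
      rw [Finset.mem_sdiff]
      refine ⟨hXU B hB he, fun h => ?_⟩
      have : e ∈ (S \ B₁) ∩ (S \ B) := Finset.mem_inter.2 ⟨h, he⟩
      rw [hdis] at this
      exact Finset.notMem_empty _ this
    have hT : ((S.erase y) \ (S \ B₁)).card = 3 := by
      rw [Finset.card_sdiff_of_subset (hXU B₁ hB₁.1), hU5, card_sdiff_of_mem_pairPre hB₁.1]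
    exact inter_nonempty_of_subset_three hT (hsub B₂ hB₂.1 h12) (hsub B₃ hB₃.1 h13)
      (card_sdiff_of_mem_pairPre hB₂.1) (card_sdiff_of_mem_pairPre hB₃.1)
  obtain ⟨B, B', hB, hB', hne, hgB, hgB', hmeet⟩ := hmeet
  obtain ⟨hc3, hyI, hI⟩ := clF_inter_subset_of_meet hG hsimple hyG hyc hS h6 hB hB' hne hmeet
  -- `B ∩ B' = {y, a, b}`; `g ∈ cl {a, b}`
  obtain ⟨a, b, hab, hab_eq⟩ : ∃ a b, a ≠ b ∧ (B ∩ B').erase y = {a, b} := by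
    have : ((B ∩ B').erase y).card = 2 := by rw [Finset.card_erase_of_mem hyI, hc3]
    exact Finset.card_eq_two.1 this
  have haI : a ∈ (B ∩ B').erase y := by rw [hab_eq]; simp
  have hbI : b ∈ (B ∩ B').erase y := by rw [hab_eq]; simp
  rw [Finset.mem_erase] at haI hbI
  have haS : a ∈ S := subset_of_mem_pairPre hB (Finset.mem_inter.1 haI.2).1
  have hbS : b ∈ S := subset_of_mem_pairPre hB (Finset.mem_inter.1 hbI.2).1
  have hgΛ : g ∈ clF M (B ∩ B') := hI (Finset.mem_inter.2 ⟨hgB, hgB'⟩)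
  have hIeq : B ∩ B' = insert y {a, b} := by rw [← hab_eq, Finset.insert_erase hyI]
  rw [hIeq] at hgΛ
  have habG : ({a, b} : Finset α) ⊆ G.erase y := by
    intro e he
    rw [Finset.mem_insert, Finset.mem_singleton] at he
    rcases he with rfl | rfl
    · exact Finset.mem_erase.2 ⟨haI.1, hSG haS⟩
    · exact Finset.mem_erase.2 ⟨hbI.1, hSG hbS⟩
  have hgy : g ≠ y := fun h => hgS (h ▸ hyS)
  have hgℓ : g ∈ clF M ({a, b} : Finset α) :=
    mem_clF_of_mem_clF_insert_coloop hyc habG (Finset.mem_erase.2 ⟨hgy, hgG⟩) hgΛ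
  have hga : g ≠ a := fun h => hgS (h ▸ haS)
  have hgb : g ≠ b := fun h => hgS (h ▸ hbS)
  -- exchange: `g ∈ cl {a, b} ∖ cl {a}` gives `b ∈ cl {a, g}`, and symmetrically `a ∈ cl {b, g}`
  have hexch : ∀ u v : α, u ∈ S → v ∈ S → g ≠ u → g ∈ clF M ({u, v} : Finset α) → v ∈ clF M ({u, g} : Finset α) := by
    intro u v huS hvS hgu hguv
    rw [mem_clF_iff] at hguv ⊢
    have hgu' : g ∉ M.closure ({u} : Set α) := by
      intro h
      have h1 : ({u, g} : Finset α) ⊆ clF M {u} := by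
        intro e he
        rw [Finset.mem_insert, Finset.mem_singleton] at he
        rcases he with rfl | rfl
        · exact subset_clF_of_subset_gr (Finset.singleton_subset_iff.2 (hGg (hSG huS))) (Finset.mem_singleton_self _)
        · rw [mem_clF_iff]; exact_mod_cast h
      have h2 := rkN_le_of_subset_clF' (M := M) h1
      have h3 := rkN_le_card_fin (M := M) ({u} : Finset α)
      rw [Finset.card_singleton] at h3
      have h4 := hsimple u (hGg (hSG huS)) g (hGg hgG) hgu.symm
      omega
    have hguv' : g ∈ M.closure (insert v ({u} : Set α)) := by
      have : ((({u, v} : Finset α)) : Set α) = insert v ({u} : Set α) := by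
        push_cast
        exact Set.pair_comm u v
      rw [← this]
      exact_mod_cast hguv
    have := Matroid.mem_closure_insert hgu' hguv'
    have hcoe : ((({u, g} : Finset α)) : Set α) = insert g ({u} : Set α) := by
      push_cast
      exact Set.pair_comm u g
    rw [hcoe]
    exact this
  -- every pair preimage with `g` in its closure has pair set `{a, b}` or a 2-subset of `S ∖ {y, a, b}`
  have hform : ∀ B'' ∈ pairPre M 4 G S, g ∈ clF M B'' →
      S \ B'' ∈ insert ({a, b} : Finset α) (Finset.powersetCard 2 ((S.erase y) \ {a, b})) := by
    intro B'' hB'' hgB''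
    have hUB'' : B'' ∈ Uq M (4 + 2) 4 := (mem_membersIn.1 (mem_pairPre.1 hB'').1).1
    have key : ∀ u v : α, u ∈ S → v ∈ S → g ≠ u → g ∈ clF M ({u, v} : Finset α) → u ∈ B'' → v ∈ clF M B'' := by
      intro u v huS hvS hgu hguv huB''
      have h1 := hexch u v huS hvS hgu hguv
      have h2 : ({u, g} : Finset α) ⊆ clF M B'' :=
        Finset.insert_subset (subset_clF hUB'' huB'') (Finset.singleton_subset_iff.2 hgB'')
      exact clF_subset_clF_of_subset_clF h2 h1
    have hgba : g ∈ clF M ({b, a} : Finset α) := by rw [Finset.pair_comm]; exact hgℓ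
    rw [Finset.mem_insert, Finset.mem_powersetCard]
    by_cases haB : a ∈ B''
    · -- then `b ∈ cl B''`, so `b ∉ X` and `a ∉ X`
      have hbcl := key a b haS hbS hga hgℓ haB
      right
      refine ⟨?_, card_sdiff_of_mem_pairPre hB''⟩
      intro e he
      rw [Finset.mem_sdiff, Finset.mem_insert, Finset.mem_singleton, not_or]
      refine ⟨hXU B'' hB'' he, fun h => (Finset.mem_sdiff.1 he).2 (h ▸ haB), fun h => ?_⟩
      exact (Finset.mem_sdiff.1 (sdiff_subset_of_mem_pairPre hB'' he)).2 (h ▸ hbcl)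
    · by_cases hbB : b ∈ B''
      · have hacl := key b a hbS haS hgb hgba hbB
        exact absurd (subset_clF hUB'' (by
          by_contra h
          exact (Finset.mem_sdiff.1 (sdiff_subset_of_mem_pairPre hB'' (Finset.mem_sdiff.2 ⟨haS, h⟩))).2 hacl)) (fun h => haB (by
            by_contra h'
            exact (Finset.mem_sdiff.1 (sdiff_subset_of_mem_pairPre hB'' (Finset.mem_sdiff.2 ⟨haS, h'⟩))).2 h))
      · left
        symm
        apply Finset.eq_of_subset_of_card_le
        · intro e he
          rw [Finset.mem_insert, Finset.mem_singleton] at he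
          rcases he with rfl | rfl
          · exact Finset.mem_sdiff.2 ⟨haS, haB⟩
          · exact Finset.mem_sdiff.2 ⟨hbS, hbB⟩
        · rw [card_sdiff_of_mem_pairPre hB'', Finset.card_pair hab]
  -- at most `1 + 3 = 4` such pair sets
  have hmaps : ∀ B'' ∈ 𝓕, S \ B'' ∈ insert ({a, b} : Finset α) (Finset.powersetCard 2 ((S.erase y) \ {a, b})) := by
    intro B'' hB''
    rw [h𝓕def, Finset.mem_filter] at hB''
    exact hform B'' hB''.1 hB''.2
  have hinj : Set.InjOn (fun B => S \ B) (𝓕 : Set (Finset α)) := by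
    intro B hB B' hB' h
    rw [Finset.mem_coe, h𝓕def, Finset.mem_filter] at hB hB'
    by_contra hne
    exact sdiff_ne_of_mem_pairPre hB.1 hB'.1 hne h
  have h1 := Finset.card_le_card_of_injOn (fun B => S \ B) hmaps hinj
  have h2 : (insert ({a, b} : Finset α) (Finset.powersetCard 2 ((S.erase y) \ {a, b}))).card ≤ 4 := by
    have h3 : ((S.erase y) \ {a, b}).card = 3 := by
      have := Finset.card_sdiff_add_card_eq_card (show ({a, b} : Finset α) ⊆ S.erase y from by
          intro e he
          rw [Finset.mem_insert, Finset.mem_singleton] at he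
          rcases he with rfl | rfl
          · exact Finset.mem_erase.2 ⟨haI.1, haS⟩
          · exact Finset.mem_erase.2 ⟨hbI.1, hbS⟩)
      rw [Finset.card_pair hab, hU5] at this
      omega
    have := Finset.card_insert_le ({a, b} : Finset α) (Finset.powersetCard 2 ((S.erase y) \ {a, b}))
    rw [Finset.card_powersetCard, h3] at this
    have h33 : Nat.choose 3 2 = 3 := by decide
    omega
  omega

open scoped Classical in
/-- **The counting bound without coloops**: `t · (|G ∖ S| − 1) ≤ 4 · |G ∖ S|`. -/
theorem mul_card_four_le {G : Finset α} (hG : G ∈ flatsQ M (4 + 1))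
    (hsimple : ∀ e ∈ gr M, ∀ f ∈ gr M, e ≠ f → rkN M {e, f} = 2) {y : α} (hyG : y ∈ G)
    (hyc : y ∉ clF M (G.erase y)) {S : Finset α} (hS : S ∈ shadowAt M (4 + 2) 4 (Uq M (4 + 2) 4) G)
    (h6 : S.card = 6) :
    ((pairPre M 4 G S).filter (fun B => (G \ clF M B).card = 3)).card * ((G \ S).card - 1) ≤
      4 * (G \ S).card := by
  have hdc := Finset.sum_card_bipartiteAbove_eq_sum_card_bipartiteBelow (fun g B => g ∈ clF M B) (s := G \ S)
    (t := pairPre M 4 G S)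
  have hL : ∑ g ∈ G \ S, (Finset.bipartiteAbove (fun g B => g ∈ clF M B) (pairPre M 4 G S) g).card ≤
      4 * (G \ S).card := by
    calc ∑ g ∈ G \ S, (Finset.bipartiteAbove (fun g B => g ∈ clF M B) (pairPre M 4 G S) g).card
        ≤ ∑ _g ∈ G \ S, 4 := by
          apply Finset.sum_le_sum
          intro g hg
          exact card_pairPre_filter_mem_clF_le_four hG hsimple hyG hyc hS h6 hg
      _ = 4 * (G \ S).card := by rw [Finset.sum_const, smul_eq_mul, mul_comm]
  have hR : ∑ B ∈ pairPre M 4 G S, (Finset.bipartiteBelow (fun g B => g ∈ clF M B) (G \ S) B).card ≥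
      ((pairPre M 4 G S).filter (fun B => (G \ clF M B).card = 3)).card * ((G \ S).card - 1) := by
    have hsub := Finset.sum_le_sum_of_subset_of_nonneg
      (f := fun B => (Finset.bipartiteBelow (fun g B => g ∈ clF M B) (G \ S) B).card)
      (Finset.filter_subset (fun B => (G \ clF M B).card = 3) (pairPre M 4 G S)) (fun _ _ _ => Nat.zero_le _)
    have hfib : ∀ B ∈ (pairPre M 4 G S).filter (fun B => (G \ clF M B).card = 3),
        (Finset.bipartiteBelow (fun g B => g ∈ clF M B) (G \ S) B).card = (G \ S).card - 1 := by
      intro B hB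
      rw [Finset.mem_filter] at hB
      have heq : Finset.bipartiteBelow (fun g B => g ∈ clF M B) (G \ S) B = (G \ S) ∩ clF M B := by
        ext e
        rw [Finset.mem_bipartiteBelow, Finset.mem_inter]
      rw [heq]
      have := card_inter_clF_of_three hS hB.1 hB.2
      omega
    rw [Finset.sum_congr rfl hfib, Finset.sum_const, smul_eq_mul] at hsub
    exact hsub
  omega

open scoped Classical in
/-- At most ten pair preimages at `|S| = 6`. -/
theorem card_pairPre_le_ten {G : Finset α} (hG : G ∈ flatsQ M (4 + 1)) {y : α} (hyG : y ∈ G)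
    (hyc : y ∉ clF M (G.erase y)) {S : Finset α} (hS : S ∈ shadowAt M (4 + 2) 4 (Uq M (4 + 2) 4) G)
    (h6 : S.card = 6) : (pairPre M 4 G S).card ≤ 10 := by
  have hyS : y ∈ S := mem_of_mem_shadowAt_of_coloop (by rw [rkN_erase_eq_of_coloop hG hyG hyc]) hS
  have hmaps : ∀ B ∈ pairPre M 4 G S, S \ B ∈ Finset.powersetCard 2 (S.erase y) := by
    intro B hB
    rw [Finset.mem_powersetCard]
    refine ⟨?_, card_sdiff_of_mem_pairPre hB⟩
    intro e he
    rw [Finset.mem_erase]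
    exact ⟨fun h => (Finset.mem_sdiff.1 he).2 (h ▸ mem_of_mem_pairPre hG hyG hyc hB), (Finset.mem_sdiff.1 he).1⟩
  have hinj : Set.InjOn (fun B => S \ B) (pairPre M 4 G S : Set (Finset α)) := by
    intro B hB B' hB' h
    by_contra hne
    exact sdiff_ne_of_mem_pairPre (Finset.mem_coe.1 hB) (Finset.mem_coe.1 hB') hne h
  have h1 := Finset.card_le_card_of_injOn (fun B => S \ B) hmaps hinj
  rw [Finset.card_powersetCard, Finset.card_erase_of_mem hyS, h6] at h1
  have h52 : Nat.choose (6 - 1) 2 = 10 := by decide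
  omega

open scoped Classical in
/-- Without a coloop of `S` besides `y`, there is no covering preimage with `|G ∖ cl B| ≥ 2`. -/
theorem r14CovPre_eq_empty_of_noColoop {G : Finset α} (hG : G ∈ flatsQ M (4 + 1)) {y : α} (hyG : y ∈ G)
    (hyc : y ∉ clF M (G.erase y)) {S : Finset α} (hno : ∀ z ∈ S, z ≠ y → z ∈ clF M (S.erase z)) :
    r14CovPre M G S = ∅ := by
  rw [Finset.eq_empty_iff_forall_notMem]
  intro B hB
  obtain ⟨z, hzS, hzy, -, hz, -⟩ := exists_coloop_of_mem_r14CovPre hG hyG hyc hB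
  exact hz (hno z hzS hzy)

end PercRepro.Shadow
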